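import Mathlib
import HarnessLib
import HarnessLib.Audit
import Summits.PneNP.Statement
import Literature.InformationTheory.NetworkCoding.OneShot
import HarnessLib.Audit.Status.Attr

/-!
Route: CodingVolumeShifts

# Route CodingVolumeShifts — unbounded one-shot coding volume of far pairs forces superlinear shift
wirings

It suffices to show X = CodingVolume (the deciding crux), typed over the landed vocabulary
`Literature.InformationTheory.NetworkCoding.KPairsNet` (finite acyclic multigraph with ι-indexed
sources/sinks), `KPairsNet.Code`
(binary ONE-SHOT network code: one bit per arc, a function of the bits entering its tail; every sink
decodes its own bit for all inputs),
`Far L` (every source–sink pair at UNDIRECTED distance ≥ L), `DegLE Δ`, `arcCount`: for every degree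
bound Δ and every constant C there
is a distance L such that every Δ-bounded k-pairs DAG whose pairs are all L-far and which carries a
binary one-shot code has at least C·k
arcs ("the one-shot coding volume of far pairs is unbounded"). The proved-now support VolumeToShifts
turns X into T = "no linear-size
bounded-degree wiring with re-programmable gates realises all n cyclic shifts" (Valiant's 1977 shift
problem, unconditional form of
AfshaniEtAl2019 Thm 2), and the declared RESIDUAL ShiftVolumeLift (S-implied) is T → P ≠ NP.
Markdown-first sketch
undirected-coding-volume-shifts (readers PASS 3/3/3/4, 2026-08-17); no idea card.
Lean: `∀ Δ C : ℕ, ∃ L : ℕ, ∀ (ι : Type) [Fintype ι] (N :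
Literature.InformationTheory.NetworkCoding.KPairsNet ι), N.DegLE Δ → N.Far L → Nonempty N.Code → C *
Fintype.card ι ≤ N.arcCount`

## Assembly
Pure logic, kernel-checked in glue.lean: `closes hX s1 hR : PneNP := hR (s1 hX)` — X gives T by the
support S1, and the residual R
carries T to the summit. All three binders are consumed (cone = 3). The Assembly item below is the
CRUX-LEVEL chain
CodingVolume → ShiftVolumeLift → PneNP (rev 1): its proof is exactly S1 (X → T) followed by R; the
rev-0 form also threaded the
support S1 through the chain and therefore unfolded to a propositional tautology (ground.trivial),
so it was restated.

Rationale: WHY THIS LINE. The undirected multiple-unicast (k-pairs) conjecture of LiLi2004 says coding never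
beats fractional multicommodity flow in undirected
networks; AdlerEtAl2006, AfshaniEtAl2019 (arXiv:1902.10935 Thm 2, §4) and DvorakEtAl2021
(arXiv:2102.09294 Conj. 1 "weaker NCC" for
DAGs) turn it into CONDITIONAL Ω(n log n) size bounds for bounded-degree circuits with arbitrary
gates computing shifts / multiplication.
This line isolates the one purely combinatorial consequence of NCC those proofs actually consume —
distance VOLUME at the integral,
alphabet-{0,1}, one-shot level (NCC ⇒ X: a code of rate 1 plus NCC gives a unit multicommodity flow,
whose k commodities each travel
≥ L undirected edges inside m unit capacities) — and attacks X unconditionally by an XOR-first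
ladder ("the graph is the code":
XorVolume, then Linearization), importing network information flow / sparsity of multicommodity
flows (information theory,
combinatorial optimisation) and F₂-linear circuit structure (JuknaBFC2012 §13.5) into Valiant's
shift problem (Valiant1977, Riis2007
§7–8, PudlakRodlSgall1997 §6). The assembly step VolumeToShifts (ball counting + averaging over
shifts + `Code.restrict`) is proved
at open up to formalisation; the rung C = 2 of X is kernel-checked (bc5). No existing PneNP route
uses network coding, k-pairs networks
or shift wirings (59 Theses files: no `KPairsNet`/`NetworkCoding`/`shift` decl), and the negatives
index (6 entries) has nothing on
information flow.

RANKED CRUXES. #2 CodingVolume (crux) — X, the deciding crux (sketch item X): ∀ Δ C ∃ L, every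
k-pairs DAG with in/out-degrees ≤ Δ, all source–sink pairs at undirected distance ≥ L, and a binary
one-shot network code has arcCount ≥ C·k. [difficulty: XL] (why it might fail: A bounded-degree DAG
family with k pairwise-far pairs, O(k) arcs and a binary one-shot code (a "coding shifter" on an
expander) refutes it and with it NCC; only C = 2 (rung) and the routing case m ≥ kL are proved,
directed coding gains are unbounded, Far sees undirected distance only.) [AfshaniEtAl2019,
arXiv:2102.09294, LiLi2004, AdlerEtAl2006, BravermanHe2025, Riis2007]
#3 ShiftVolumeLift (crux) — DECLARED RESIDUAL (S-implied; the honest gap between the volume ladder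
and the summit): if for every Δ, K and all large n no k-pairs DAG on commodities Fin n with degrees
≤ Δ and ≤ K·n arcs realises all n cyclic shifts with re-programmable gates (a binary one-shot code
for every shifted pairing), then P ≠ NP. [difficulty: open-problem] (why it might fail: The
hypothesis is a superlinear size bound for ONE explicit P-computable operator under arbitrary gates;
no lift from such a bound to NP ⊄ P/poly or P ≠ NP is known or expected (P = NP is consistent with
it) — residual, never attacked here.) [Valiant1977, Riis2007, PudlakRodlSgall1997, AfshaniEtAl2019]
#9 VolumeToShifts (support) — S1 (provable now): CodingVolume implies that for every Δ, K there is
n₀ such that no k-pairs DAG on Fin n (n ≥ n₀) with degrees ≤ Δ and ≤ K·n arcs realises all cyclic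
shifts — take C := K+1 and its L; in the undirected graph (degree ≤ 2Δ) each input has < B :=
(2Δ+1)^L outputs within distance < L, so by averaging over the n shifts (Σ_s #{i : d(in_i,
out_{i+s}) < L} ≤ n·B) some shift s has at least n − B far pairs; restrict the shift-s code to them
(`Code.restrict`), getting a far sub-network with the same ≤ K·n arcs and ≥ n − B commodities,
contradicting (K+1)(n − B) ≤ K·n once n > (K+1)·B. [deps: CodingVolume] [difficulty: provable-now]
(why it might fail: Only through a print-to-tree mismatch (ball bound via `SimpleGraph.edist` on a
multigraph's `fromRel` graph; `rewire`/`Code.restrict` bookkeeping); the averaging argument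
(AfshaniEtAl2019 §4, Lemma 4) is not in doubt.) [AfshaniEtAl2019, Pippenger1990Networks,
JuknaBFC2012]

TWO-LAYER PLAN. Foreseen glued splits (registered as BIRTH SKELETONS under
Cruxes/<Decl>/Lines/birth.lean, not filed as items): CodingVolume ⇐
XorVolume → Linearization → CodingVolume (`codingVolume_of`, proved): XorVolume = the same volume
statement for XOR networks
(`XorNet`: every non-source node carries the F₂-sum of its in-neighbours, sink i carries e_i; no
separate code), Linearization = a
binary one-shot code never saves more than a constant factor of volume over an XOR network at any
distance scale; below XorVolume the
next split is XorVolumeDegTwo → XorDegreeReduction → XorVolume (`xorVolume_of`, proved).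
ShiftVolumeLift ⇐ (T → NP ⊄ P/poly) →
(NP ⊄ P/poly → P ≠ NP) (`shiftVolumeLift_of`), recorded only to make the residual's distance to the
summit explicit.

KILL CRITERIA. ¬CodingVolume by an explicit family (bounded degree, all pairs L-far for every L
along the family, O(k) arcs, a binary one-shot
code) closes the route `refuted:CodingVolume` — and refutes the undirected multiple-unicast
conjecture at the integral one-shot level,
a result in itself. ¬XorVolume (an F₂-linear such family) kills the XOR-first ladder and forces a
pivot to a direct entropy/compression
attack on CodingVolume or closure. A proof of T (superlinear shift wirings) elsewhere moots X and S1
and leaves only the residual R;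
R is never attacked here and its refutation is not expected to be decidable.

NOT DECOMPOSED YET. The constants of Linearization (Δ', c), the degree-reduction gadget for XOR
networks, the exact ball bound (2Δ+1)^L vs 2Δ(2Δ−1)^{L−1},
the entropy/compression form of X (H of the arc bits crossing a ball boundary), and any regime split
by distance scale L versus log k —
all layer-2 stubs of the birth skeletons or prover-attached lemmas, not items.

CHEAPEST FALSIFIER. For CodingVolume: an exhaustive/SAT search over small DAGs (≤ 10 internal nodes,
Δ = 2, k ≤ 5) for a binary one-shot code with all
pairs at undirected distance ≥ 3 and fewer than 3k arcs — one kit job; any hit is a counterexample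
pattern to tensor up. Lookup run
instead (2026-08-17): `lit search --hybrid` / `lit vsearch` for an integral
coding-vs-distance-volume gap in undirected or DAG
k-pairs instances found only rate-level results (coding gap ≤ O(log k) for multi-source unicast,
BravermanHe2025 p.4; none below NCC),
no counterexample family. For the line: the rung C = 2 is proved (bc/CodingVolume_rung.lean); C = 3
at Δ = 2 is the first open cell.

NUMBERS. Conditional ceiling of the family: NCC ⇒ size Ω(n log n) for bounded-degree shift /
multiplication circuits with arbitrary gates
(AfshaniEtAl2019 Thm 1–2), matched by O(n log n)-size, O(log n)-depth shifting networks
(Pippenger1990Networks §2.4), so volume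
arguments on SHIFTS cap at Θ(n log n); routing-only n-shifters need Ω(n log n) edges (Pippenger–Yao,
in Pippenger1990Networks §2.4);
unconditionally no superlinear size bound is known for any explicit operator under arbitrary gates
and unbounded depth (JuknaBFC2012
§13, PDF pp.380, 391–392). Coding gap for multi-source unicast in undirected graphs: unknown whether
> 1; ≤ O(log k) (BravermanHe2025
p.4). Rung proved here: C = 2 at L = 2 for every Δ (2k ≤ m). Items: 4 (2 cruxes incl. 1 residual, 1
support, 1 assembly — the assembly restated at rev 1 to the crux-level chain X → R → PneNP, provable
from S1 by modus ponens).

DEFINITION REQUESTS. None outstanding: `KPairsNet`, `KPairsNet.Code`, `Far`, `DegLE`, `arcCount`,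
`rewire`, `Code.restrict`, `shiftNet`, `RealizesAllShifts`,
`XorNet` (+ `XorNet.Far/DegLE/arcCount`) landed in
Literature/InformationTheory/NetworkCoding/OneShot.lean (p171876, commit
51982b436c8a). Entropic rates / general alphabets / multicommodity flows are deliberately not
requested: X is stated below them.

Novelty: Searches (2026-08-17): `lit search --hybrid "multiple unicast network coding undirected graphs
conjecture multicommodity flow"` (8; only generic coding/optimisation books, blake2024 pp.124–125
has no k-pairs content); `lit vsearch "network coding achieves no higher rate than fractional
multicommodity flow in undirected graphs"` (10; same); `lit search --hybrid "cyclic shift circuit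
size n log n lower bound arbitrary gates bounded fan-in superconcentrator"` (8; JuknaBFC2012 PDF
pp.380/388/391, AroraBarak2009 p.360); `lit read arxiv:2102.09294 --grep Conjecture` (Conj. 1 weaker
NCC p.8; (δ,d)-long networks p.10; shift instance p.13); `lit read arxiv:2510.18737 --grep unicast`
(p.3–4: conjecture open, implies circuit lower bounds via afshani2019lower); `lit galaxy search
"multiple unicast conjecture|k-pairs conjecture" --star pdf` (2: pdf:3718548630611381620 Cai–Han
2020 Langberg–Médard MUC, pdf:6116040439364985040); `lit galaxy search "network coding conjecture"
--star panama` (3: panama:128453881888869 EUROCRYPT 2020 (NCC-conditional sorting/ORAM bounds),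
panama:353140801011735); `lit galaxy search "shifting network|n-shifter|cyclic shifts require"
--star pdf` and `"Network Coding Conjecture implies|assuming the network coding conjecture" --star
pdf` (both rc 1 queue-saturated twice, recorded as null); `lean search
KPairsNet|NetworkCoding|shiftNet` over PneNP Theses (0 outside Literature); `ledger negatives
--problem PneNP` (6, none on information flow); plus the sketch's reco  [refs: 10.37236/962, 2102.09294, 2510.18737, 1902.10935, arxiv:2102.09294, arxiv:2510.18737, doi:10.37236/962, JuknaBFC2012, AroraBarak2009, AfshaniEtAl2019, DvorakEtAl2021, AdlerEtAl2006, Riis2007]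

Barriers (technique_class: network-coding-volume, k-pairs, shift-wirings): - technique_class: network-coding, information-flow, coding-vs-routing-volume,
undirected-k-pairs-conjecture, one-shot-binary-network-codes, xor-networks, shifting-networks,
circuits-with-arbitrary-gates, superlinear-circuit-lower-bounds
- Literature.Barriers.PneNP.SuperconcentratorBarrier: outside — X and S1 use the undirected DISTANCE
volume consumed by k simultaneously decodable commodities, not the superconcentrator/connectivity
property of the wiring (the entry's scope caveat (a): "SME-type information flow … different
techniques"); a linear-size superconcentrator is not a counterexample to X unless it also carries a
far one-shot code with O(k) arcs, which is exactly what X denies.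
- Literature.Barriers.PneNP.SuperconcentratorBarrierLogDepth: outside for the same reason; the line
never restricts depth and never argues from disjoint paths.
- Literature.Barriers.PneNP.NaturalProofs: outside as typed — X/S1/T concern O(n)-size
bounded-degree wirings of one explicit linear-time operator; the property "not realisable by K·n
arcs at degree Δ" is useful only against linear size, not against P/poly where the RR theorem
(conditional on hard PRGs in P/poly) bites; it bites the residual R only.
- Literature.Barriers.PneNP.Relativization: does not quantify over X/S1 (finite statements about
networks and codes, no oracle machines); bites only the residual R, declared and not attacked.
- Literature.Barriers.PneNP.Algebrization: same placement as Relativization — outside for X/S1, bite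

History (route lifecycle, newest last):
- 2026-08-17T18:59:47Z · rev 1: restated Assembly (stmt-PneNP-19457) — route-repair (ground-failed): restate item Assembly (stmt-PneNP-19457), the only ground flag (ground.trivial, detail tauto). Rev-0 Assembly := CodingVolume → Vo (planner-rground-PneNP-CodingVolumeShifts-de40c8a2-0)

sub-problem: PneNP · status: open · opened planner-type-0b9a68a6a2-0 2026-08-17T18:38:26Z · rev 1 · ledger route-PneNP-CodingVolumeShifts
GENERATED by the gate from the ledger (D-0016/17). Provers cite these decls: `theorem foo : Summit.PneNP.PneNP.Theses.CodingVolumeShifts.<Decl> := …` in Summits/PneNP/PneNP/Theorems/<Name>.lean.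
-/

namespace Summit.PneNP.PneNP.Theses.CodingVolumeShifts

open scoped BigOperators Topology Manifold Classical MeasureTheory ProbabilityTheory Matrix InnerProductSpace ComplexConjugate ContinuousMap
open Filter Set Function TopologicalSpace MeasureTheory

attribute [summit_statement] _root_.PneNP

open Literature.PNP

/-- item stmt-PneNP-19454 · crux · rank 2 · open · by planner
why it might fail: A bounded-degree DAG family with k pairwise-far pairs, O(k) arcs and a binary one-shot code (a "coding shifter" on an expander) refutes it and with it NCC; only C = 2 (rung) and the routing case m ≥ kL are proved, directed coding gains are unbounded, Far sees undirected distance only.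
sources: AfshaniEtAl2019, arXiv:2102.09294, LiLi2004, AdlerEtAl2006, BravermanHe2025, Riis2007
[crux] X, the deciding crux (sketch item X): ∀ Δ C ∃ L, every k-pairs DAG with in/out-degrees ≤ Δ,
all source–sink pairs at undirected distance ≥ L, and a binary one-shot network code has arcCount ≥
C·k. [difficulty: XL] -/
@[route_item "route-PneNP-CodingVolumeShifts", crux]
def CodingVolume : Prop :=
  ∀ Δ C : ℕ, ∃ L : ℕ, ∀ (ι : Type) [Fintype ι] (N : Literature.InformationTheory.NetworkCoding.KPairsNet ι), N.DegLE Δ → N.Far L → Nonempty N.Code → C * Fintype.card ι ≤ N.arcCount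

/-- item stmt-PneNP-19455 · crux · rank 3 · open · by planner
why it might fail: The hypothesis is a superlinear size bound for ONE explicit P-computable operator under arbitrary gates; no lift from such a bound to NP ⊄ P/poly or P ≠ NP is known or expected (P = NP is consistent with it) — residual, never attacked here.
sources: Valiant1977, Riis2007, PudlakRodlSgall1997, AfshaniEtAl2019
[crux] DECLARED RESIDUAL (S-implied; the honest gap between the volume ladder and the summit): if
for every Δ, K and all large n no k-pairs DAG on commodities Fin n with degrees ≤ Δ and ≤ K·n arcs
realises all n cyclic shifts with re-programmable gates (a binary one-shot code for every shifted
pairing), then P ≠ NP. [difficulty: open-problem] -/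
@[route_item "route-PneNP-CodingVolumeShifts", crux]
def ShiftVolumeLift : Prop :=
  (∀ Δ K : ℕ, ∃ n₀ : ℕ, ∀ n ≥ n₀, ∀ W : Literature.InformationTheory.NetworkCoding.KPairsNet (Fin n), W.DegLE Δ → W.arcCount ≤ K * n → ¬ W.RealizesAllShifts) → PneNP

/-- item stmt-PneNP-19456 · support · rank 9 · closed · proved by Summit.PneNP.PneNP.Theorems.codingVolumeShifts_volumeToShifts_proof (prover) · by planner
why it might fail: Only through a print-to-tree mismatch (ball bound via `SimpleGraph.edist` on a multigraph's `fromRel` graph; `rewire`/`Code.restrict` bookkeeping); the averaging argument (AfshaniEtAl2019 §4, Lemma 4) is not in doubt.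
sources: AfshaniEtAl2019, Pippenger1990Networks, JuknaBFC2012
[support] S1 (provable now): CodingVolume implies that for every Δ, K there is n₀ such that no
k-pairs DAG on Fin n (n ≥ n₀) with degrees ≤ Δ and ≤ K·n arcs realises all cyclic shifts — take C :=
K+1 and its L; in the undirected graph (degree ≤ 2Δ) each input has < B := (2Δ+1)^L outputs within
distance < L, so by averaging over the n shifts (Σ_s #{i : d(in_i, out_{i+s}) < L} ≤ n·B) some shift
s has at least n − B far pairs; restrict the shift-s code to them (`Code.restrict`), getting a far
sub-network with the same ≤ K·n arcs and ≥ n − B commodities, contradicting (K+1)(n − B) ≤ K·n once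
n > (K+1)·B. [deps: CodingVolume] [difficulty: provable-now] -/
@[route_item "route-PneNP-CodingVolumeShifts", crux]
def VolumeToShifts : Prop :=
  CodingVolume → ∀ Δ K : ℕ, ∃ n₀ : ℕ, ∀ n ≥ n₀, ∀ W : Literature.InformationTheory.NetworkCoding.KPairsNet (Fin n), W.DegLE Δ → W.arcCount ≤ K * n → ¬ W.RealizesAllShifts

-- `VolumeToShifts` holds: proved by `Summit.PneNP.PneNP.Theorems.codingVolumeShifts_volumeToShifts_proof` (its module imports this route file, so no `_holds` link can be stated here).

-- earlier Assembly (stmt-PneNP-19457, replaced 2026-08-17T18:59:47Z -> stmt-PneNP-19895): retired by None — CodingVolume → VolumeToShifts → ShiftVolumeLift → PneNP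
/-- item stmt-PneNP-19895 · assembly · rank 1 · closed · proved by Summit.PneNP.PneNP.Theorems.codingVolumeShifts_assembly_proof (prover) · by planner
sources: AfshaniEtAl2019, Riis2007
[assembly] CodingVolume → ShiftVolumeLift → P ≠ NP: the two cruxes imply the summit. Proof route:
the support VolumeToShifts (S1: X → T, ball counting + averaging over the n cyclic shifts +
Code.restrict) followed by the residual R = ShiftVolumeLift (T → P ≠ NP), i.e. `fun hX hR => hR (s1
hX)` once S1 is proved. (Rev-0 form `CodingVolume → VolumeToShifts → ShiftVolumeLift → PneNP`
threaded S1 itself through the chain and unfolded to a propositional tautology —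
ground.trivial/tauto — hence this restatement; `closes` is unchanged.) -/
@[route_item "route-PneNP-CodingVolumeShifts"]
def Assembly : Prop :=
  CodingVolume → ShiftVolumeLift → PneNP

-- `Assembly` holds: proved by `Summit.PneNP.PneNP.Theorems.codingVolumeShifts_assembly_proof` (its module imports this route file, so no `_holds` link can be stated here).

/-! D-0027 §2.1 — DECIDING THEOREM (planner-authored via `route open/edit --closes-file`; by planner-type-0b9a68a6a2-0 2026-08-17T18:38:26Z):
its hypotheses are this route's items and its conclusion the sub-problem Statement (glue_lint), and it elaborates with this file. -/

/-- The deciding theorem: the coding-volume statement (`CodingVolume`, X) feeds the proved-now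
averaging step (`VolumeToShifts`, S1: ball counting in a bounded-degree graph + averaging over the
`n` cyclic shifts + restriction of a one-shot code to the far pairs), which yields "no linear-size
bounded-degree wiring with re-programmable gates realises all cyclic shifts"; the declared residual
(`ShiftVolumeLift`, R) carries that to `P ≠ NP`. All three binders are consumed. -/
@[closes "route-PneNP-CodingVolumeShifts"] theorem closes (hX : CodingVolume) (s1 : VolumeToShifts) (hR : ShiftVolumeLift) : PneNP :=
  hR (s1 hX)

end Summit.PneNP.PneNP.Theses.CodingVolumeShifts
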